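import Literature.NumberTheory.Automorphic.ArchStableOrbitalSumRepresentatives  -- ★ (V8)-orb (same author, g9): `sum_eq_card_fiber_smul_sum_image`, `card_filter_mk_archDiagTorus_eq_prod_factorial` (fibres of `ρ ↦ ⟦t(z∘ρ)⟧` have `Π_w p_w!(N−p_w)!` elements); brings ★ (V8) `conjClasses_stable_archDiagTorus_eq_range`
import Mathlib.MeasureTheory.Group.Integral                                    -- `integral_mul_right_eq_self`
import Literature.NumberTheory.Rogawski1990.ArchInnerTransferCongruence        -- ★ (T-d) FILE 2: `isStablyConj_archCongr_iff` (§4, through a frame)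
import HarnessLib

/-!
# The regular archimedean stable class of a torus point, summed in HAAR currency: `M_α · Σ_{c ∈ st(t(z))} I(out c) = Σ_{ρ ∈ Π_w S_N} I(t(z ∘ ρ))` with the EXPLICIT,
# system-free label multiplicity `M_α = Π_w p_w!(N − p_w)!` (node N3-c of SdArch ED. 3; Rogawski 1990 §3.7 Prop. 3.7.1, §8.2 Prop. 8.2.1, §4.1 (4.1.1))

Topic `NumberTheory/Rogawski1990`; namespace `Literature.NumberTheory.Rogawski1990` (§1 under `Literature.NumberTheory.Automorphic.UnitaryGroup`, next to ★ (V8)).  THEOREMS ONLY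
(kernel lane, count-neutral `--supports` H413; no `def`, no instance, no notation, no `sorry`).  Cell `pub/hodgecm-mathlib`, ENGINE T1 (crux H413 =
`stmt-HodgeConjecture-24833`); ROAD-Sd residual R4, SdArch ED. 3 (F0P3a-p03 (g11) design 7141d221, N5 census 783c9612 §4 «shape of the class sum: ★ (V8) → labels `σ`,
EXPLICIT nonzero `A, B` … the label multiplicities `∏_w |W_{K,w}|`»); node N3-c «stable-class finsum ↔ Weyl labels» = the LEFT-hand side of N4 FILE B (A-p14 (g28) «=» 08:03:09Z,
A-p13 (g31) imports); typed by F0P3a-p02 (g11), 2026-09-01.  Rank-free twin of ★ 3H FILE A∕B (`ArchEndoscopicStableClasses`∕`…StableSumTorus`, `N = 2`, `Bool` labels).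

THE POINT.  At a regular torus point `t(z)` of `U(diag α)(L ⊗ ℝ)` (`α` hermitian non-degenerate; `z_w` injective at every place) ★ (V8) lists the classes of the stable class as
`{⟦t(z ∘ ρ)⟧ ∣ ρ ∈ Π_w S_N}` (`conjClasses_stable_archDiagTorus_eq_range`) and ★ (V8)-orb counts the fibres of `ρ ↦ ⟦t(z ∘ ρ)⟧`: all have `M_α := Π_w p_w!(N − p_w)!` elements,
`p_w = #{i ∣ re σ_w α_i > 0}` (`card_filter_mk_archDiagTorus_eq_prod_factorial`).  Hence for ANY class function `I` (e.g. a Haar-currency orbital integral `x ↦ ∫ a(h x h⁻¹) dν(h)`,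
`ν` right-invariant) the LABEL SUM `Σ_ρ I(t(z ∘ ρ))` counts each class of the stable class exactly `M_α` times — `M_α` is EXPLICIT, independent of `z`, of the test function and
of the measure («system-free», N5 §4 (i)); for `N = 3`: `2` at a `(2,1)` place, `6` at a definite one.  (★ (V8)-orb states the same average for CLASS orbital integrals
`Φ(⟦·⟧, a; m)` — `archStableOrbitalIntegral_archDiagTorus_eq_inv_mul_sum_classOrbitalIntegral`; here the summand is an arbitrary class function, in particular the HAAR integral.)
§1 `labelCount_mul_finsum_stable_archDiagTorus_eq_sum_perm` — the ABSTRACT label identity for a class function `I` on `U(diag α)(L ⊗ ℝ)`.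
§2 `labelCount_mul_finsum_integral_comp_conj_eq_sum_perm` — HAAR currency: `I x := ∫ a(h·x·h⁻¹) dν(h)`, `ν` right-invariant, ANY `a` (Mathlib `integral_mul_right_eq_self`).
§3 `labelCount_mul_finsum_integral_comp_conj_archCongr_symm_eq_sum_perm` — THROUGH A FRAME `Φ : U(H₂)(L ⊗ ℝ) ≃ₜ* U(diag γ)(L ⊗ ℝ)`, `g ↦ T g T⁻¹` (★ N3-b convention; `Φ := Ψ_Q` for the
   quasi-split `U(Φ₃)`): the stable class of `Φ⁻¹(t(z))` in `U(H₂)` summed in Haar currency = the label sum over `Φ⁻¹(t(z ∘ ρ))`, same `M_γ` (class-set transport ★ `isStablyConj_archCongr_iff`).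
Chain for N4 FILE B ∕ N5: ★ A-p14 FILE A (finsum identity at `(t_α(z), Ψ_Q⁻¹ t_β(z))`, ★ N3-b `corresponds_archDiagTorus_archCongr_symm_archDiagTorus`) → §3 on `G′`, §4 on `G` → ★ N3-b
`exists_integral_comp_conj_archCongr_symm_eq_mul_integral_pi(_map_conj)` per label.
HONEST LABEL: HC_CM is proved only modulo the printed citations until rung 0 closes; this file is class bookkeeping and pays nothing by itself.

## References
* [Rogawski1990] J. D. Rogawski, *Automorphic Representations of Unitary Groups in Three Variables* (1990), §3.7 Prop. 3.7.1 pp. 29–30, §8.2 Prop. 8.2.1 p. 118 (classes in a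
  regular stable class ↔ sign-compatible permutations), §4.1 (4.1.1) p. 39 (`Φ^st = Σ Φ`), §14.4 p. 237, §1.7 p. 6.
* [BrockerTomDieck1985] T. Bröcker, T. tom Dieck, *Representations of Compact Lie Groups* (1985), Ch. IV (3.2) (Weyl group of `U(p) × U(q)` in `S_N`).
-/

open MeasureTheory Measure Equiv NumberField NumberField.InfinitePlace NumberField.mixedEmbedding
open scoped Classical

/-! ## §1 The abstract label identity for a class function -/

namespace Literature.NumberTheory.Automorphic

namespace UnitaryGroup

open Literature.NumberTheory.Rogawski1990

section Torus

variable (L : Type) [Field L] [NumberField L] [IsCMField L] (N : ℕ) (α : Fin N → L)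



/-- **`M_α · Σ_{c ∈ st(t(z))} I(out c) = Σ_{ρ ∈ Π_w S_N} I(t(z ∘ ρ))` FOR EVERY CLASS FUNCTION `I`** on `U(diag α)(L ⊗ ℝ)` at a regular torus point: the regular stable class is the
range of the class map (★ `conjClasses_stable_archDiagTorus_eq_range`), each class is hit `M_α` times (★ `sum_eq_card_fiber_smul_sum_image`), and `I` does not see the representative.
`M_α = Π_w p_w!(N − p_w)!` (★ `card_filter_mk_archDiagTorus_eq_prod_factorial`) is explicit and depends on `(N, α)` only. [cite: Rogawski1990, §3.7 Prop. 3.7.1 pp. 29–30; §4.1 (4.1.1) p. 39] [cite: BrockerTomDieck1985, Ch. IV (3.2)] -/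
theorem labelCount_mul_finsum_stable_archDiagTorus_eq_sum_perm (hα : ∀ i, α i ≠ 0) (hherm : ∀ i, (IsCMField.complexConj L (α i) : L) = α i)
    {z : {w : InfinitePlace L // IsComplex w} → Fin N → Circle} (hz : ∀ w, Function.Injective (z w))
    (I : arch (↥(maximalRealSubfield L)) L (IsCMField.complexConj L) N (Matrix.diagonal α) → ℂ)
    (hI : ∀ x k : arch (↥(maximalRealSubfield L)) L (IsCMField.complexConj L) N (Matrix.diagonal α), I (k * x * k⁻¹) = I x) :
    ((∏ w : {w : InfinitePlace L // IsComplex w},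
        (Finset.univ.filter fun i => 0 < (w.1.embedding (α i)).re).card.factorial *
          (N - (Finset.univ.filter fun i => 0 < (w.1.embedding (α i)).re).card).factorial : ℕ) : ℂ) *
      ∑ᶠ c ∈ {c : ConjClasses (arch (↥(maximalRealSubfield L)) L (IsCMField.complexConj L) N (Matrix.diagonal α)) |
          IsStablyConj (conjMixed (↥(maximalRealSubfield L)) L (IsCMField.complexConj L)) (archFormOf L N (Matrix.diagonal α))
            (archDiagTorus L N α z) (Quotient.out c)}, I (Quotient.out c) =
    ∑ ρ : {w : InfinitePlace L // IsComplex w} → Perm (Fin N), I (archDiagTorus L N α fun w => z w ∘ ⇑(ρ w)) := by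
  -- `I` on a class does not depend on the representative
  have hout : ∀ x : arch (↥(maximalRealSubfield L)) L (IsCMField.complexConj L) N (Matrix.diagonal α), I (Quotient.out (ConjClasses.mk x)) = I x := by
    intro x
    obtain ⟨k, hk⟩ := isConj_iff.1 (ConjClasses.mk_eq_mk_iff_isConj.1 (Quotient.out_eq (ConjClasses.mk x)).symm)
    rw [← hk]
    exact hI x k
  -- (i) the stable class is the image of the class map `ρ ↦ ⟦t(z ∘ ρ)⟧`, a finite set
  have hset : {c : ConjClasses (arch (↥(maximalRealSubfield L)) L (IsCMField.complexConj L) N (Matrix.diagonal α)) |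
      IsStablyConj (conjMixed (↥(maximalRealSubfield L)) L (IsCMField.complexConj L)) (archFormOf L N (Matrix.diagonal α))
        (archDiagTorus L N α z) (Quotient.out c)} =
      ↑(Finset.univ.image fun ρ : {w : InfinitePlace L // IsComplex w} → Perm (Fin N) => ConjClasses.mk (archDiagTorus L N α fun w => z w ∘ ⇑(ρ w))) := by
    rw [conjClasses_stable_archDiagTorus_eq_range L N α hα hherm hz, Finset.coe_image, Finset.coe_univ, Set.image_univ]
  rw [hset, finsum_mem_coe_finset]
  -- (ii) the label sum counts each class `Π_w p_w!(N − p_w)!` times (★ (V8)-orb)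
  have hsum := sum_eq_card_fiber_smul_sum_image
    (fun ρ : {w : InfinitePlace L // IsComplex w} → Perm (Fin N) => ConjClasses.mk (archDiagTorus L N α fun w => z w ∘ ⇑(ρ w)))
    (fun q => I (Quotient.out q)) _ (card_filter_mk_archDiagTorus_eq_prod_factorial L N α hα hherm hz)
  beta_reduce at hsum
  simp only [hout] at hsum
  rw [hsum, nsmul_eq_mul]

end Torus

end UnitaryGroup

end Literature.NumberTheory.Automorphic

/-! ## §2–§3 Haar currency, on the diagonal carrier and through a frame -/

namespace Literature.NumberTheory.Rogawski1990

open Literature.NumberTheory.Automorphic Literature.NumberTheory.Automorphic.UnitaryGroup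

section Haar

variable (L : Type) [Field L] [NumberField L] [IsCMField L] (N : ℕ) (α : Fin N → L)
  [MeasurableSpace (arch (↥(maximalRealSubfield L)) L (IsCMField.complexConj L) N (Matrix.diagonal α))]
  [BorelSpace (arch (↥(maximalRealSubfield L)) L (IsCMField.complexConj L) N (Matrix.diagonal α))]

/-- **N3-c, DIAGONAL CARRIER: THE REGULAR STABLE CLASS SUMMED IN HAAR CURRENCY = THE LABEL SUM.**  For `ν` right-invariant on `U(diag α)(L ⊗ ℝ)` and ANY `a`:
`M_α · Σ_{c ∈ st(t(z))} ∫ a(h·out c·h⁻¹) dν(h) = Σ_{ρ ∈ Π_w S_N} ∫ a(h·t(z ∘ ρ)·h⁻¹) dν(h)`, `M_α = Π_w p_w!(N − p_w)!` explicit (§1 at the class function `x ↦ ∫ a(h x h⁻¹) dν`,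
conjugation-invariant by right-invariance).  LEFT = the Haar-currency stable sum of ★ N4 FILE A `…_of_isArchInnerTransfer` at `γ′ = t(z)`; RIGHT = the label sum ★ N3-b reads as product-torus
integrals. [cite: Rogawski1990, §4.1 (4.1.1) p. 39; §3.7 Prop. 3.7.1 pp. 29–30; §1.7 p. 6] -/
theorem labelCount_mul_finsum_integral_comp_conj_eq_sum_perm (hα : ∀ i, α i ≠ 0) (hherm : ∀ i, (IsCMField.complexConj L (α i) : L) = α i)
    {z : {w : InfinitePlace L // IsComplex w} → Fin N → Circle} (hz : ∀ w, Function.Injective (z w))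
    (ν : Measure (arch (↥(maximalRealSubfield L)) L (IsCMField.complexConj L) N (Matrix.diagonal α))) [ν.IsMulRightInvariant]
    (a : arch (↥(maximalRealSubfield L)) L (IsCMField.complexConj L) N (Matrix.diagonal α) → ℂ) :
    ((∏ w : {w : InfinitePlace L // IsComplex w},
        (Finset.univ.filter fun i => 0 < (w.1.embedding (α i)).re).card.factorial *
          (N - (Finset.univ.filter fun i => 0 < (w.1.embedding (α i)).re).card).factorial : ℕ) : ℂ) *
      ∑ᶠ c ∈ {c : ConjClasses (arch (↥(maximalRealSubfield L)) L (IsCMField.complexConj L) N (Matrix.diagonal α)) |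
          IsStablyConj (conjMixed (↥(maximalRealSubfield L)) L (IsCMField.complexConj L)) (archFormOf L N (Matrix.diagonal α))
            (archDiagTorus L N α z) (Quotient.out c)}, ∫ h, a (h * Quotient.out c * h⁻¹) ∂ν =
    ∑ ρ : {w : InfinitePlace L // IsComplex w} → Perm (Fin N), ∫ h, a (h * archDiagTorus L N α (fun w => z w ∘ ⇑(ρ w)) * h⁻¹) ∂ν :=
  labelCount_mul_finsum_stable_archDiagTorus_eq_sum_perm L N α hα hherm hz (fun x => ∫ h, a (h * x * h⁻¹) ∂ν) fun x k => by
    show ∫ h, a (h * (k * x * k⁻¹) * h⁻¹) ∂ν = ∫ h, a (h * x * h⁻¹) ∂ν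
    calc ∫ h, a (h * (k * x * k⁻¹) * h⁻¹) ∂ν = ∫ h, (fun g => a (g * x * g⁻¹)) (h * k) ∂ν := by
          congr 1
          funext h
          simp only [mul_assoc, mul_inv_rev]
      _ = ∫ h, a (h * x * h⁻¹) ∂ν := integral_mul_right_eq_self (fun g => a (g * x * g⁻¹)) k

end Haar

section Frame

variable (L : Type) [Field L] [NumberField L] [IsCMField L] {N : ℕ} {H₂ : Matrix (Fin N) (Fin N) L} (γ : Fin N → L) (T : GL (Fin N) (mixedSpace L))
  (Φ : arch (↥(maximalRealSubfield L)) L (IsCMField.complexConj L) N H₂ ≃ₜ* arch (↥(maximalRealSubfield L)) L (IsCMField.complexConj L) N (Matrix.diagonal γ))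
  (hΦ : ∀ g : arch (↥(maximalRealSubfield L)) L (IsCMField.complexConj L) N H₂,
    ((Φ g : arch (↥(maximalRealSubfield L)) L (IsCMField.complexConj L) N (Matrix.diagonal γ)) : GL (Fin N) (mixedSpace L)) = T * (g : GL (Fin N) (mixedSpace L)) * T⁻¹)
  [MeasurableSpace (arch (↥(maximalRealSubfield L)) L (IsCMField.complexConj L) N H₂)]
  [BorelSpace (arch (↥(maximalRealSubfield L)) L (IsCMField.complexConj L) N H₂)]

include hΦ in
/-- **N3-c THROUGH A FRAME** (`Φ : U(H₂) ≃ U(diag γ)`, `g ↦ T g T⁻¹`; `Φ := Ψ_Q` for the quasi-split `U(Φ₃)(L ⊗ ℝ)`): for `ν` right-invariant on `U(H₂)(L ⊗ ℝ)` and ANY `a`,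
`M_γ · Σ_{c ∈ st(Φ⁻¹ t(z))} ∫ a(h·out c·h⁻¹) dν(h) = Σ_{ρ} ∫ a(h·Φ⁻¹(t(z ∘ ρ))·h⁻¹) dν(h)` — §1 on `U(diag γ)` for the class function `x ↦ ∫ a(h·Φ⁻¹x·h⁻¹) dν`, the stable class of `Φ⁻¹ t(z)` in
`U(H₂)` being carried to that of `t(z)` by `c ↦ ⟦Φ(out c)⟧` (★ `isStablyConj_archCongr_iff`). [cite: Rogawski1990, §14.4 p. 237; §4.1 (4.1.1) p. 39; §3.7 Prop. 3.7.1 pp. 29–30] -/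
theorem labelCount_mul_finsum_integral_comp_conj_archCongr_symm_eq_sum_perm (hγ : ∀ i, γ i ≠ 0) (hherm : ∀ i, (IsCMField.complexConj L (γ i) : L) = γ i)
    {z : {w : InfinitePlace L // IsComplex w} → Fin N → Circle} (hz : ∀ w, Function.Injective (z w))
    (ν : Measure (arch (↥(maximalRealSubfield L)) L (IsCMField.complexConj L) N H₂)) [ν.IsMulRightInvariant]
    (a : arch (↥(maximalRealSubfield L)) L (IsCMField.complexConj L) N H₂ → ℂ) :
    ((∏ w : {w : InfinitePlace L // IsComplex w},
        (Finset.univ.filter fun i => 0 < (w.1.embedding (γ i)).re).card.factorial *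
          (N - (Finset.univ.filter fun i => 0 < (w.1.embedding (γ i)).re).card).factorial : ℕ) : ℂ) *
      ∑ᶠ c ∈ {c : ConjClasses (arch (↥(maximalRealSubfield L)) L (IsCMField.complexConj L) N H₂) |
          IsStablyConj (conjMixed (↥(maximalRealSubfield L)) L (IsCMField.complexConj L)) (archFormOf L N H₂)
            (Φ.symm (archDiagTorus L N γ z)) (Quotient.out c)}, ∫ h, a (h * Quotient.out c * h⁻¹) ∂ν =
    ∑ ρ : {w : InfinitePlace L // IsComplex w} → Perm (Fin N), ∫ h, a (h * Φ.symm (archDiagTorus L N γ fun w => z w ∘ ⇑(ρ w)) * h⁻¹) ∂ν := by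
  -- the class function on `U(diag γ)` read through `Φ⁻¹`
  have hconj : ∀ x k : arch (↥(maximalRealSubfield L)) L (IsCMField.complexConj L) N H₂,
      ∫ h, a (h * (k * x * k⁻¹) * h⁻¹) ∂ν = ∫ h, a (h * x * h⁻¹) ∂ν := fun x k => by
    calc ∫ h, a (h * (k * x * k⁻¹) * h⁻¹) ∂ν = ∫ h, (fun g => a (g * x * g⁻¹)) (h * k) ∂ν := by
          congr 1
          funext h
          simp only [mul_assoc, mul_inv_rev]
      _ = ∫ h, a (h * x * h⁻¹) ∂ν := integral_mul_right_eq_self (fun g => a (g * x * g⁻¹)) k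
  have hI : ∀ x k : arch (↥(maximalRealSubfield L)) L (IsCMField.complexConj L) N (Matrix.diagonal γ),
      ∫ h, a (h * Φ.symm (k * x * k⁻¹) * h⁻¹) ∂ν = ∫ h, a (h * Φ.symm x * h⁻¹) ∂ν := fun x k => by
    rw [map_mul, map_mul, map_inv]
    exact hconj (Φ.symm x) (Φ.symm k)
  have hout : ∀ y : arch (↥(maximalRealSubfield L)) L (IsCMField.complexConj L) N H₂,
      ∫ h, a (h * Quotient.out (ConjClasses.mk y) * h⁻¹) ∂ν = ∫ h, a (h * y * h⁻¹) ∂ν := fun y => by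
    obtain ⟨k, hk⟩ := isConj_iff.1 (ConjClasses.mk_eq_mk_iff_isConj.1 (Quotient.out_eq (ConjClasses.mk y)).symm)
    rw [← hk]
    exact hconj y k
  rw [← labelCount_mul_finsum_stable_archDiagTorus_eq_sum_perm L N γ hγ hherm hz (fun x => ∫ h, a (h * Φ.symm x * h⁻¹) ∂ν) hI]
  congr 1
  -- transport of the index set along `c_γ ↦ ⟦Φ⁻¹ (out c_γ)⟧`
  refine (finsum_mem_eq_of_bijOn (fun cγ => ConjClasses.mk (Φ.symm (Quotient.out cγ))) ⟨?_, ?_, ?_⟩ fun cγ _ => ?_).symm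
  · -- maps the stable class of `t(z)` into that of `Φ⁻¹ t(z)`
    intro cγ hcγ
    have h1 : IsStablyConj (conjMixed (↥(maximalRealSubfield L)) L (IsCMField.complexConj L)) (archFormOf L N H₂)
        (Φ.symm (archDiagTorus L N γ z)) (Φ.symm (Quotient.out cγ)) := by
      rw [← isStablyConj_archCongr_iff L T Φ hΦ, ContinuousMulEquiv.apply_symm_apply, ContinuousMulEquiv.apply_symm_apply]
      exact hcγ
    exact h1.trans (isStablyConj_of_isConj
      (ConjClasses.mk_eq_mk_iff_isConj.1 (Quotient.out_eq (ConjClasses.mk (Φ.symm (Quotient.out cγ)))).symm))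
  · -- injective
    intro c₁ _ c₂ _ h12
    have h : IsConj (Φ.symm (Quotient.out c₁)) (Φ.symm (Quotient.out c₂)) := ConjClasses.mk_eq_mk_iff_isConj.1 h12
    have h' : IsConj (Quotient.out c₁ : arch (↥(maximalRealSubfield L)) L (IsCMField.complexConj L) N (Matrix.diagonal γ)) (Quotient.out c₂) := by
      obtain ⟨k, hk⟩ := isConj_iff.1 h
      refine isConj_iff.2 ⟨Φ k, ?_⟩
      have hk' := congrArg Φ hk
      rwa [map_mul, map_mul, map_inv, ContinuousMulEquiv.apply_symm_apply, ContinuousMulEquiv.apply_symm_apply] at hk'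
    have e1 : ConjClasses.mk (Quotient.out c₁) = c₂ := (ConjClasses.mk_eq_mk_iff_isConj.2 h').trans (Quotient.out_eq c₂)
    have e2 : ConjClasses.mk (Quotient.out c₁) = c₁ := Quotient.out_eq c₁
    exact e2.symm.trans e1
  · -- surjective onto the stable class of `Φ⁻¹ t(z)`
    intro c hc
    refine ⟨ConjClasses.mk (Φ (Quotient.out c)), ?_, ?_⟩
    · have h1 : IsStablyConj (conjMixed (↥(maximalRealSubfield L)) L (IsCMField.complexConj L)) (archFormOf L N (Matrix.diagonal γ))
          (archDiagTorus L N γ z) (Φ (Quotient.out c)) := by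
        have h2 := (isStablyConj_archCongr_iff L T Φ hΦ (Φ.symm (archDiagTorus L N γ z)) (Quotient.out c)).2 hc
        rwa [ContinuousMulEquiv.apply_symm_apply] at h2
      exact h1.trans (isStablyConj_of_isConj
        (ConjClasses.mk_eq_mk_iff_isConj.1 (Quotient.out_eq (ConjClasses.mk (Φ (Quotient.out c)))).symm))
    · show ConjClasses.mk (Φ.symm (Quotient.out (ConjClasses.mk (Φ (Quotient.out c))))) = c
      have h3 : IsConj (Φ (Quotient.out c)) (Quotient.out (ConjClasses.mk (Φ (Quotient.out c)))) :=
        ConjClasses.mk_eq_mk_iff_isConj.1 (Quotient.out_eq (ConjClasses.mk (Φ (Quotient.out c)))).symm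
      have h4 : IsConj (Quotient.out c) (Φ.symm (Quotient.out (ConjClasses.mk (Φ (Quotient.out c))))) := by
        obtain ⟨k, hk⟩ := isConj_iff.1 h3
        refine isConj_iff.2 ⟨Φ.symm k, ?_⟩
        have hk' := congrArg Φ.symm hk
        rwa [map_mul, map_mul, map_inv, ContinuousMulEquiv.symm_apply_apply] at hk'
      exact (ConjClasses.mk_eq_mk_iff_isConj.2 h4).symm.trans (Quotient.out_eq c)
  · -- summands agree
    show ∫ h, a (h * Φ.symm (Quotient.out cγ) * h⁻¹) ∂ν = ∫ h, a (h * Quotient.out (ConjClasses.mk (Φ.symm (Quotient.out cγ))) * h⁻¹) ∂ν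
    rw [hout]

end Frame

end Literature.NumberTheory.Rogawski1990
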